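import Mathlib.Analysis.Complex.Basic
import Literature.Computability.AlgebraicComplexity.StandardFamilies

/-!
# Route LiftNullstellensatz — `LiftWidthPerFour` (stmt-ValiantsHypothesis-5922), line `outer_layers`:
# the uniform STAGED target `(V⁺)` for CASE A (definitions only)

Definitions file for the line `Cruxes/LiftWidthPerFour/Lines/outer_layers.lean` (`--supports
stmt-ValiantsHypothesis-5922`; typed at director-valiant's request 2026-08-27T23:03Z: "(V⁺) is the
target of record for `stub_caseA`").  No theorem is asserted here.

Fix two rows `i₀ ≠ i₁` of the generic `4 × 4` matrix and two linear forms `ℓ, ℓ'`.  Put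
`X̂ := (ℓ, x_{i₀,0}, …, x_{i₀,3})` (`rowHat i₀ ℓ`), `Ξ̂ := (ℓ', x_{i₁,0}, …, x_{i₁,3})`,
`𝔪_X := (X̂)`, `𝔪_Ξ := (Ξ̂)` and `𝔫 := 𝔪_X · 𝔪_Ξ · (𝔪_X + 𝔪_Ξ)²`.

* **`CaseAVPlus i₀ i₁ ℓ ℓ'`** — `(V⁺)(ℓ,ℓ')` of the crux workfile
  `Cruxes/LiftWidthPerFour/STAGED-CERT-p1g2.md` §7: for all `5 × 5` matrices `L₂, L₃` of linear forms,
  `per_4 − X̂ᵀ L₂ L₃ Ξ̂ ∉ 𝔫`.  When `ℓ, ℓ'` are coordinates transverse to the two rows this says that the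
  Taylor tower of the equation `per_4 = X̂ᵀ L₂ L₃ Ξ̂` along `V(X̂, Ξ̂)` is already inconsistent at
  STAGE 1 ∧ STAGE 2 (bidegrees `(1,1)`, `(2,1)`, `(1,2)` in `(X̂, Ξ̂)`); since an exact width-`5` outer-layer
  ABP `per_4 = Σ_{s<5} v_s v'_s`, `v_s ∈ (X̂)₂`, `v'_s ∈ (Ξ̂)₂`, gives `per_4 − X̂ᵀ L₂ L₃ Ξ̂ = 0 ∈ 𝔫`,
  `(∀ i₀ ≠ i₁, ∀ ℓ ℓ', CaseAVPlus i₀ i₁ ℓ ℓ')` implies the registered stub `stub_caseA`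
  (`Summit.ValiantsHypothesis.LiftNullstellensatz.stub_caseA_of_vplus`, file `…CaseAOfVPlus.lean`, is
  literally this implication with `CaseAVPlus` unfolded).
  STATUS (honest): proved in the kernel for `ℓ = ℓ' = 0` in the stronger exact form (`caseA_zero`,
  file `…CaseAZero.lean`); numerically `(V)` ⊂ `(V⁺)` holds at 73/73 sampled stage-1 points of the
  exceptional pairs (kit j293138, artefact sha256 ea7d68af…); OPEN in general.  Nothing here bears on
  VP ≠ VNP beyond the crux `LiftWidthPerFour` it serves.
-/

noncomputable section

open MvPolynomial

namespace Summit.ValiantsHypothesis.LiftNullstellensatz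

open Literature.Computability.AlgebraicComplexity

/-- The augmented row vector `X̂ = (ℓ, x_{i,0}, x_{i,1}, x_{i,2}, x_{i,3})` of a row `i` and a linear
form `ℓ`: `rowHat i ℓ 0 = ℓ`, `rowHat i ℓ j.succ = x_{i,j}`; its range is `insert ℓ {x_{i,·}}`
(`Fin.range_cons`), so `Ideal.span (Set.range (rowHat i ℓ))` is the ideal `(x_{i,·}, ℓ)` of the
outer-layer normal form. [folklore] -/
def rowHat (i : Fin 4) (ℓ : MvPolynomial (Fin 4 × Fin 4) ℂ) :
    Fin 5 → MvPolynomial (Fin 4 × Fin 4) ℂ :=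
  Fin.cons ℓ fun j : Fin 4 => (X (i, j) : MvPolynomial (Fin 4 × Fin 4) ℂ)

/-- **`(V⁺)(ℓ,ℓ')` for the rows `i₀, i₁`** (crux workfile `STAGED-CERT-p1g2.md` §7): with
`𝔪_X = (rowHat i₀ ℓ)`, `𝔪_Ξ = (rowHat i₁ ℓ')`, for all `5 × 5` matrices `L₂, L₃` of linear forms
`per_4 − Σ_{j,s,k} X̂_j (L₂)_{js} (L₃)_{sk} Ξ̂_k ∉ 𝔪_X 𝔪_Ξ (𝔪_X + 𝔪_Ξ)²`.  OPEN in general (see the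
module docstring for what is proved; the problem is that of Bläser–Ikenmeyer–Mahajan–Pandey–Saurabh
2020 §2). -/
def CaseAVPlus (i₀ i₁ : Fin 4) (ℓ ℓ' : MvPolynomial (Fin 4 × Fin 4) ℂ) : Prop :=
  ∀ L₂ L₃ : Fin 5 → Fin 5 → MvPolynomial (Fin 4 × Fin 4) ℂ,
    (∀ j s, (L₂ j s).IsHomogeneous 1) → (∀ s k, (L₃ s k).IsHomogeneous 1) →
    perPoly (Fin 4) ℂ - ∑ j, ∑ s, ∑ k, rowHat i₀ ℓ j * L₂ j s * L₃ s k * rowHat i₁ ℓ' k ∉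
      Ideal.span (Set.range (rowHat i₀ ℓ)) * Ideal.span (Set.range (rowHat i₁ ℓ')) *
        (Ideal.span (Set.range (rowHat i₀ ℓ)) ⊔ Ideal.span (Set.range (rowHat i₁ ℓ'))) ^ 2

end Summit.ValiantsHypothesis.LiftNullstellensatz

end
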